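import Summits.AtomisticToContinuum.Crystallization.Theorems.ChessboardParticlePlanesPeriodicWindowsEnvelopeTail

/-!
# Envelope numerics for `PeriodicWindows` (stmt-AtomisticToContinuum-3240), stub E2b — anisotropic cube shells, the far tail, summability

The tail bound for the UNBOUNDED patterns `(lo, false)` (layers `k ≥ lo`): the anisotropic cubes
`envCube r m = [-rm,rm] × [-m,m]²`, their shells (`≤ r(24m²+2)` sites; on shell `m ≥ K+1` every term is
`≤ (α m²)^{-e}` provided `0 < α ≤ 3/5` and `α (K+1)² ≤ (rK+1)² t`), the telescoping estimate
`∑_{m>K} m⁻⁴ ≤ 1/(3K(K-1)(K-2))` of `…PinTail`, whence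
`∑_s term ≤ ∑_{envBox lo nk K} term + envTail3 r α e K` for every finite `s` when `rK + 1 ≤ lo + nk`;
consequences for all patterns: summability of `envSum` (`e ≥ 3`, `t > 0`), `box ≤ envSum ≤ box + tail`,
nonnegativity and antitonicity in `t`, and `envSum 0 0 true e t = envIn e`.  [folklore]
-/

noncomputable section

namespace Summit.AtomisticToContinuum.Crystallization.Theorems.PeriodicWindowsSketch

open Finset Summit.AtomisticToContinuum.Crystallization.Theorems.ExcessDecayLiouvilleCoarseGrains

/-! ## Anisotropic cubes and shells -/

/-- Membership in the anisotropic cube. [folklore] -/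
theorem env_mem_envCube {r m : ℕ} {v : ℤ × ℤ × ℤ} :
    v ∈ envCube r m ↔ |v.1| ≤ ((r * m : ℕ) : ℤ) ∧ |v.2.1| ≤ m ∧ |v.2.2| ≤ m := by
  obtain ⟨k, i, j⟩ := v
  simp only [envCube, Finset.mem_product, Finset.mem_Icc, abs_le]

/-- The cubes increase. [folklore] -/
theorem envCube_mono (r : ℕ) {m m' : ℕ} (h : m ≤ m') : envCube r m ⊆ envCube r m' := by
  intro v hv
  rw [env_mem_envCube] at hv ⊢
  have h1 : ((r * m : ℕ) : ℤ) ≤ ((r * m' : ℕ) : ℤ) := by exact_mod_cast Nat.mul_le_mul_left r h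
  have h2 : (m : ℤ) ≤ m' := by exact_mod_cast h
  exact ⟨hv.1.trans h1, hv.2.1.trans h2, hv.2.2.trans h2⟩

/-- `#([-rm,rm] × [-m,m]²) = (2rm+1)(2m+1)²`. [folklore] -/
theorem env_card_envCube (r m : ℕ) : (envCube r m).card = (2 * (r * m) + 1) * (2 * m + 1) ^ 2 := by
  simp only [envCube, Finset.card_product, Int.card_Icc]
  have h1 : (((r * m : ℕ) : ℤ) + 1 - -((r * m : ℕ) : ℤ)).toNat = 2 * (r * m) + 1 := by omega
  have h2 : ((m : ℤ) + 1 - -(m : ℤ)).toNat = 2 * m + 1 := by omega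
  rw [h1, h2]; ring

/-- An anisotropic shell has at most `r(24m² + 2)` sites (exactly `24rm² - 8rm + 8m + 2r`). [folklore] -/
theorem env_card_cubeShell_le {r m : ℕ} (hr : 1 ≤ r) (hm : 1 ≤ m) :
    ((envCube r m \ envCube r (m - 1)).card : ℝ) ≤ (r : ℝ) * (24 * (m : ℝ) ^ 2 + 2) := by
  rw [Finset.card_sdiff_of_subset (envCube_mono r (Nat.sub_le m 1)), env_card_envCube, env_card_envCube]
  obtain ⟨n, rfl⟩ : ∃ n, m = n + 1 := ⟨m - 1, by omega⟩
  simp only [Nat.add_sub_cancel]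
  have h : (2 * (r * n) + 1) * (2 * n + 1) ^ 2 ≤ (2 * (r * (n + 1)) + 1) * (2 * (n + 1) + 1) ^ 2 :=
    Nat.mul_le_mul (by nlinarith) (Nat.pow_le_pow_left (by omega) 2)
  rw [Nat.cast_sub h]
  push_cast
  have hr' : (1 : ℝ) ≤ r := by exact_mod_cast hr
  nlinarith [sq_nonneg (n : ℝ), (show (0 : ℝ) ≤ n by positivity)]

/-- Outside the cube some coordinate is large. [folklore] -/
theorem env_not_mem_envCube {r m : ℕ} {v : ℤ × ℤ × ℤ} :
    v ∉ envCube r m ↔ ((r * m : ℕ) : ℤ) + 1 ≤ |v.1| ∨ (m : ℤ) + 1 ≤ |v.2.1| ∨ (m : ℤ) + 1 ≤ |v.2.2| := by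
  rw [env_mem_envCube]; omega

/-- **The layer direction on a shell**: if `α (K+1)² ≤ (rK+1)² t`, `r ≥ 1`, `t ≥ 0`, then for every
`d' ≥ 0`, `α (K+1+d')² ≤ (rK+1+rd')² t`. [folklore] -/
theorem env_layer_shell_ineq {r K d' : ℕ} (hr : 1 ≤ r) {α t : ℝ} (ht : 0 ≤ t)
    (hcond : α * ((K : ℝ) + 1) ^ 2 ≤ ((r : ℝ) * K + 1) ^ 2 * t) :
    α * ((K : ℝ) + 1 + d') ^ 2 ≤ ((r : ℝ) * K + 1 + r * d') ^ 2 * t := by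
  set A : ℝ := (r : ℝ) * K + 1 with hA
  have hr' : (1 : ℝ) ≤ r := by exact_mod_cast hr
  have hK0 : (0 : ℝ) ≤ K := by positivity
  have hd0 : (0 : ℝ) ≤ d' := by positivity
  have hA0 : 0 ≤ A := by positivity
  have h1 : A * ((K : ℝ) + 1 + d') ≤ (A + r * d') * ((K : ℝ) + 1) := by
    rw [hA]; nlinarith
  have h2 : (A * ((K : ℝ) + 1 + d')) ^ 2 ≤ ((A + r * d') * ((K : ℝ) + 1)) ^ 2 :=
    pow_le_pow_left₀ (by positivity) h1 2
  have hK1 : (0 : ℝ) < ((K : ℝ) + 1) ^ 2 := by positivity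
  have h3 : α * ((K : ℝ) + 1 + d') ^ 2 * ((K : ℝ) + 1) ^ 2 ≤ (A + r * d') ^ 2 * t * ((K : ℝ) + 1) ^ 2 := by
    have h4 : α * ((K : ℝ) + 1) ^ 2 * ((K : ℝ) + 1 + d') ^ 2 ≤ A ^ 2 * t * ((K : ℝ) + 1 + d') ^ 2 :=
      mul_le_mul_of_nonneg_right hcond (by positivity)
    have h5 : A ^ 2 * t * ((K : ℝ) + 1 + d') ^ 2 ≤ (A + r * d') ^ 2 * ((K : ℝ) + 1) ^ 2 * t := by
      have := mul_le_mul_of_nonneg_right h2 ht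
      calc A ^ 2 * t * ((K : ℝ) + 1 + d') ^ 2 = (A * ((K : ℝ) + 1 + d')) ^ 2 * t := by ring
        _ ≤ ((A + r * d') * ((K : ℝ) + 1)) ^ 2 * t := this
        _ = _ := by ring
    nlinarith
  exact le_of_mul_le_mul_right h3 hK1

/-- **Shell bound for the terms**: under the tail hypotheses, every term on the shell `m ≥ K+1` (i.e. off
`envCube r (m-1)`) is `≤ (α m²)^{-e}`. [folklore] -/
theorem envTerm_le_of_cubeShell (d lo : ℕ) (bdd : Bool) (e : ℕ) {t : ℝ} (ht : 0 ≤ t) {α : ℝ} (hα : 0 < α)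
    (hα' : α ≤ 3 / 5) {r K : ℕ} (hr : 1 ≤ r) (hK : 4 ≤ K)
    (hcond : α * ((K : ℝ) + 1) ^ 2 ≤ ((r : ℝ) * K + 1) ^ 2 * t) {m : ℕ} (hm : K + 1 ≤ m)
    {v : ℤ × ℤ × ℤ} (hv : v ∉ envCube r (m - 1)) :
    envTerm d lo bdd e t v ≤ ((α * (m : ℝ) ^ 2)⁻¹) ^ e := by
  obtain ⟨d', rfl⟩ : ∃ d', m = K + 1 + d' := ⟨m - (K + 1), by omega⟩
  have hm1 : K + 1 + d' - 1 = K + d' := by omega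
  rw [hm1, env_not_mem_envCube] at hv
  have hm4 : 4 ≤ K + 1 + d' := by omega
  have hmpos : (0 : ℝ) < ((K + 1 + d' : ℕ) : ℝ) := by positivity
  have hx : 0 < α * (((K + 1 + d' : ℕ) : ℝ)) ^ 2 := by positivity
  apply envTerm_le_of_le ht hx
  have hQ := hcpSumQ_nonneg ((d : ℤ), v.2.1, v.2.2)
  have hk2 : 0 ≤ (v.1 : ℝ) ^ 2 * t := by positivity
  rcases hv with hk | hi | hj
  · -- the layer direction
    have hlay := env_layer_shell_ineq (K := K) (d' := d') hr ht hcond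
    have hk' : ((r : ℝ) * K + 1 + r * d') ≤ |(v.1 : ℝ)| := by
      have : (((r * (K + d') : ℕ) : ℤ) + 1 : ℝ) ≤ |(v.1 : ℝ)| := by
        rw [← Int.cast_abs]; exact_mod_cast hk
      push_cast at this
      linarith
    have hkk : ((r : ℝ) * K + 1 + r * d') ^ 2 ≤ (v.1 : ℝ) ^ 2 := by
      calc ((r : ℝ) * K + 1 + r * d') ^ 2 ≤ |(v.1 : ℝ)| ^ 2 := pow_le_pow_left₀ (by positivity) hk' 2
        _ = _ := sq_abs _
    have : α * ((K : ℝ) + 1 + d') ^ 2 ≤ (v.1 : ℝ) ^ 2 * t :=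
      hlay.trans (mul_le_mul_of_nonneg_right hkk ht)
    push_cast
    linarith
  · have hi' : ((K + 1 + d' : ℕ) : ℤ) ≤ |v.2.1| := by push_cast at hi ⊢; linarith
    have h := env_Q_ge_of_fst (d : ℤ) (j := v.2.2) hm4 hi'
    have : α * (((K + 1 + d' : ℕ) : ℝ)) ^ 2 ≤ 3 / 5 * (((K + 1 + d' : ℕ) : ℝ)) ^ 2 :=
      mul_le_mul_of_nonneg_right hα' (by positivity)
    linarith
  · have hj' : ((K + 1 + d' : ℕ) : ℤ) ≤ |v.2.2| := by push_cast at hj ⊢; linarith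
    have h := env_Q_ge_of_snd (d : ℤ) (i := v.2.1) hm4 hj'
    have : α * (((K + 1 + d' : ℕ) : ℝ)) ^ 2 ≤ 3 / 5 * (((K + 1 + d' : ℕ) : ℝ)) ^ 2 :=
      mul_le_mul_of_nonneg_right hα' (by positivity)
    linarith

/-- **Sum over one anisotropic shell**: `≤ r(24m²+2) (α m²)^{-e}`. [folklore] -/
theorem env_sum_cubeShell_le (d lo : ℕ) (bdd : Bool) (e : ℕ) {t : ℝ} (ht : 0 ≤ t) {α : ℝ} (hα : 0 < α)
    (hα' : α ≤ 3 / 5) {r K : ℕ} (hr : 1 ≤ r) (hK : 4 ≤ K)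
    (hcond : α * ((K : ℝ) + 1) ^ 2 ≤ ((r : ℝ) * K + 1) ^ 2 * t) {m : ℕ} (hm : K + 1 ≤ m) :
    ∑ v ∈ envCube r m \ envCube r (m - 1), envTerm d lo bdd e t v ≤
      (r : ℝ) * (24 * (m : ℝ) ^ 2 + 2) * ((α * (m : ℝ) ^ 2)⁻¹) ^ e := by
  have hbound : ∀ v ∈ envCube r m \ envCube r (m - 1), envTerm d lo bdd e t v ≤ ((α * (m : ℝ) ^ 2)⁻¹) ^ e :=
    fun v hv => envTerm_le_of_cubeShell d lo bdd e ht hα hα' hr hK hcond hm (Finset.mem_sdiff.1 hv).2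
  have hnn : 0 ≤ ((α * (m : ℝ) ^ 2)⁻¹) ^ e := by positivity
  calc ∑ v ∈ envCube r m \ envCube r (m - 1), envTerm d lo bdd e t v
      ≤ ∑ _v ∈ envCube r m \ envCube r (m - 1), ((α * (m : ℝ) ^ 2)⁻¹) ^ e := Finset.sum_le_sum hbound
    _ = ((envCube r m \ envCube r (m - 1)).card : ℝ) * ((α * (m : ℝ) ^ 2)⁻¹) ^ e := by
        rw [Finset.sum_const, nsmul_eq_mul]
    _ ≤ (r : ℝ) * (24 * (m : ℝ) ^ 2 + 2) * ((α * (m : ℝ) ^ 2)⁻¹) ^ e :=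
        mul_le_mul_of_nonneg_right (env_card_cubeShell_le hr (by omega)) hnn

/-- The anisotropic shell bound in telescopable form: for `e ≥ 3`, `m ≥ K+1 ≥ 2`, `α > 0`,
`r(24m²+2)(α m²)^{-e} ≤ 25 r α^{-e} / ((K+1)^{2e-6} m⁴)`. [folklore] -/
theorem env_cubeShell_bound_le {e K m r : ℕ} (he : 3 ≤ e) (hK : 1 ≤ K) (hm : K + 1 ≤ m) {α : ℝ} (hα : 0 < α) :
    (r : ℝ) * (24 * (m : ℝ) ^ 2 + 2) * ((α * (m : ℝ) ^ 2)⁻¹) ^ e ≤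
      25 * r * (α⁻¹) ^ e / ((K : ℝ) + 1) ^ (2 * e - 6) * ((m : ℝ) ^ 4)⁻¹ := by
  have hm2 : (2 : ℝ) ≤ m := by exact_mod_cast (show 2 ≤ m by omega)
  have hKm : (K : ℝ) + 1 ≤ m := by exact_mod_cast hm
  have hr0 : (0 : ℝ) ≤ r := by positivity
  obtain ⟨d, rfl⟩ : ∃ d, e = d + 3 := ⟨e - 3, by omega⟩
  have h26 : 2 * (d + 3) - 6 = 2 * d := by omega
  rw [h26]
  have hl : (r : ℝ) * (24 * (m : ℝ) ^ 2 + 2) * ((α * (m : ℝ) ^ 2)⁻¹) ^ (d + 3) =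
      (r : ℝ) * ((24 * (m : ℝ) ^ 2 + 2) * (α⁻¹) ^ (d + 3) / ((m : ℝ) ^ 2) ^ (d + 3)) := by
    rw [mul_inv, mul_pow, inv_pow]
    ring
  have hrr : 25 * (r : ℝ) * (α⁻¹) ^ (d + 3) / ((K : ℝ) + 1) ^ (2 * d) * ((m : ℝ) ^ 4)⁻¹ =
      (r : ℝ) * (25 * (α⁻¹) ^ (d + 3) / (((K : ℝ) + 1) ^ (2 * d) * (m : ℝ) ^ 4)) := by
    rw [div_mul_eq_mul_div]
    field_simp
  rw [hl, hrr]
  refine mul_le_mul_of_nonneg_left ?_ hr0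
  rw [div_le_div_iff₀ (by positivity) (by positivity)]
  have hαe : (0 : ℝ) < (α⁻¹) ^ (d + 3) := by positivity
  have key : (24 * (m : ℝ) ^ 2 + 2) * (((K : ℝ) + 1) ^ (2 * d) * (m : ℝ) ^ 4) ≤
      25 * ((m : ℝ) ^ 2) ^ (d + 3) := by
    have h1 : ((K : ℝ) + 1) ^ (2 * d) ≤ (m : ℝ) ^ (2 * d) := pow_le_pow_left₀ (by positivity) hKm _
    have h2 : ((m : ℝ) ^ 2) ^ (d + 3) = (m : ℝ) ^ (2 * d) * (m : ℝ) ^ 4 * (m : ℝ) ^ 2 := by ring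
    have h25 : 24 * (m : ℝ) ^ 2 + 2 ≤ 25 * (m : ℝ) ^ 2 := by nlinarith
    have hm4 : (0 : ℝ) ≤ (m : ℝ) ^ 4 := by positivity
    rw [h2]
    calc (24 * (m : ℝ) ^ 2 + 2) * (((K : ℝ) + 1) ^ (2 * d) * (m : ℝ) ^ 4)
        ≤ (25 * (m : ℝ) ^ 2) * ((m : ℝ) ^ (2 * d) * (m : ℝ) ^ 4) := by
          apply mul_le_mul h25 (mul_le_mul_of_nonneg_right h1 hm4) (by positivity) (by positivity)
      _ = 25 * ((m : ℝ) ^ (2 * d) * (m : ℝ) ^ 4 * (m : ℝ) ^ 2) := by ring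
  calc (24 * (m : ℝ) ^ 2 + 2) * (α⁻¹) ^ (d + 3) * (((K : ℝ) + 1) ^ (2 * d) * (m : ℝ) ^ 4)
      = (α⁻¹) ^ (d + 3) * ((24 * (m : ℝ) ^ 2 + 2) * (((K : ℝ) + 1) ^ (2 * d) * (m : ℝ) ^ 4)) := by ring
    _ ≤ (α⁻¹) ^ (d + 3) * (25 * ((m : ℝ) ^ 2) ^ (d + 3)) := mul_le_mul_of_nonneg_left key hαe.le
    _ = 25 * (α⁻¹) ^ (d + 3) * ((m : ℝ) ^ 2) ^ (d + 3) := by ring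

/-- **Cube differences are below the far tail**: for every `K' ≥ K`,
`∑_{envCube r K' ∖ envCube r K} term ≤ envTail3 r α e K`. [folklore] -/
theorem env_sum_sdiff_envCube_le (d lo : ℕ) (bdd : Bool) {e : ℕ} (he : 3 ≤ e) {t : ℝ} (ht : 0 ≤ t) {α : ℝ}
    (hα : 0 < α) (hα' : α ≤ 3 / 5) {r K : ℕ} (hr : 1 ≤ r) (hK : 4 ≤ K)
    (hcond : α * ((K : ℝ) + 1) ^ 2 ≤ ((r : ℝ) * K + 1) ^ 2 * t) {K' : ℕ} (h : K ≤ K') :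
    ∑ v ∈ envCube r K' \ envCube r K, envTerm d lo bdd e t v ≤ envTail3 r α e K := by
  have main : ∑ v ∈ envCube r K' \ envCube r K, envTerm d lo bdd e t v ≤
      25 * r * (α⁻¹) ^ e / ((K : ℝ) + 1) ^ (2 * e - 6) * ∑ m ∈ Finset.Ioc K K', ((m : ℝ) ^ 4)⁻¹ := by
    induction K', h using Nat.le_induction with
    | base => simp
    | succ K' hKK' ih =>
      have hsplit : envCube r (K' + 1) \ envCube r K =
          (envCube r (K' + 1) \ envCube r K') ∪ (envCube r K' \ envCube r K) :=
        (Finset.sdiff_union_sdiff_cancel (envCube_mono r (Nat.le_succ K')) (envCube_mono r hKK')).symm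
      have hdisj : Disjoint (envCube r (K' + 1) \ envCube r K') (envCube r K' \ envCube r K) :=
        Finset.disjoint_left.2 fun v h1 h2 => (Finset.mem_sdiff.1 h1).2 (Finset.mem_sdiff.1 h2).1
      rw [hsplit, Finset.sum_union hdisj, Finset.sum_Ioc_succ_top hKK', mul_add]
      have hshell := env_sum_cubeShell_le d lo bdd e ht hα hα' hr hK hcond (m := K' + 1) (by omega)
      rw [show K' + 1 - 1 = K' from rfl] at hshell
      have hsb := env_cubeShell_bound_le (e := e) (K := K) (m := K' + 1) (r := r) he (by omega) (by omega) hα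
      push_cast at hshell hsb ⊢
      linarith
  refine main.trans ?_
  have htel := hcpSum_sum_Ioc_inv_pow_four_le (K := K) (K' := K') (by omega) h
  have hpos : 0 ≤ 25 * r * (α⁻¹) ^ e / ((K : ℝ) + 1) ^ (2 * e - 6) := by positivity
  have hK3 : (3 : ℝ) ≤ K := by exact_mod_cast (show 3 ≤ K by omega)
  have hK'3 : (3 : ℝ) ≤ K' := by exact_mod_cast (show 3 ≤ K' by omega)
  have hdrop : 1 / 3 * (1 / ((K : ℝ) * (K - 1) * (K - 2)) - 1 / ((K' : ℝ) * (K' - 1) * (K' - 2))) ≤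
      1 / 3 / ((K : ℝ) * (K - 1) * (K - 2)) := by
    have : 0 ≤ 1 / ((K' : ℝ) * (K' - 1) * (K' - 2)) := by
      have : (0:ℝ) < K' - 2 := by linarith
      have : (0:ℝ) < K' - 1 := by linarith
      positivity
    have e1 : (1:ℝ) / 3 / ((K : ℝ) * (K - 1) * (K - 2)) = 1 / 3 * (1 / ((K : ℝ) * (K - 1) * (K - 2))) := by
      ring
    linarith
  calc 25 * r * (α⁻¹) ^ e / ((K : ℝ) + 1) ^ (2 * e - 6) * ∑ m ∈ Finset.Ioc K K', ((m : ℝ) ^ 4)⁻¹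
      ≤ 25 * r * (α⁻¹) ^ e / ((K : ℝ) + 1) ^ (2 * e - 6) * (1 / 3 / ((K : ℝ) * (K - 1) * (K - 2))) :=
        mul_le_mul_of_nonneg_left (htel.trans hdrop) hpos
    _ = envTail3 r α e K := by unfold envTail3; ring

/-! ## Finite sums are bounded by box + far tail -/

/-- Membership in the evaluator box. [folklore] -/
theorem env_mem_envBox {lo nk K : ℕ} {v : ℤ × ℤ × ℤ} :
    v ∈ envBox lo nk K ↔ ((lo : ℤ) ≤ v.1 ∧ v.1 < lo + nk) ∧ |v.2.1| ≤ K ∧ |v.2.2| ≤ K := by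
  obtain ⟨k, i, j⟩ := v
  simp only [envBox, Finset.mem_product, Finset.mem_image, Finset.mem_range, Finset.mem_Icc, abs_le]
  constructor
  · rintro ⟨⟨kk, hkk, rfl⟩, hi, hj⟩
    refine ⟨⟨?_, ?_⟩, hi, hj⟩
    · push_cast; omega
    · push_cast; omega
  · rintro ⟨⟨h1, h2⟩, hi, hj⟩
    refine ⟨⟨(k - lo).toNat, by omega, by push_cast; omega⟩, hi, hj⟩

/-- The isotropic cube sits in the anisotropic one for `r ≥ 1`. [folklore] -/
theorem hcpSumCube_subset_envCube {r : ℕ} (hr : 1 ≤ r) (K : ℕ) : hcpSumCube K ⊆ envCube r K := by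
  intro v hv
  rw [hcpSum_mem_hcpSumCube] at hv
  rw [env_mem_envCube]
  have : (K : ℤ) ≤ ((r * K : ℕ) : ℤ) := by exact_mod_cast Nat.le_mul_of_pos_left K hr
  exact ⟨hv.1.trans this, hv.2.1, hv.2.2⟩

/-- **Finite sums of an unbounded pattern are bounded by box + far tail**: for `e ≥ 3`, `t ≥ 0`,
`0 < α ≤ 3/5`, `r ≥ 1`, `K ≥ 4`, `α (K+1)² ≤ (rK+1)² t`, `rK + 1 ≤ lo + nk` and every finite `s ⊆ ℤ³`,
`∑_s term ≤ ∑_{envBox lo nk K} term + envTail3 r α e K`. [folklore] -/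
theorem env_far_sum_le (d lo : ℕ) {e : ℕ} (he : 3 ≤ e) {t : ℝ} (ht : 0 ≤ t) {α : ℝ} (hα : 0 < α)
    (hα' : α ≤ 3 / 5) {r K nk : ℕ} (hr : 1 ≤ r) (hK : 4 ≤ K)
    (hcond : α * ((K : ℝ) + 1) ^ 2 ≤ ((r : ℝ) * K + 1) ^ 2 * t) (hnk : r * K + 1 ≤ lo + nk)
    (s : Finset (ℤ × ℤ × ℤ)) :
    ∑ v ∈ s, envTerm d lo false e t v ≤ ∑ v ∈ envBox lo nk K, envTerm d lo false e t v + envTail3 r α e K := by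
  obtain ⟨K', hKK', hs⟩ := hcpSum_exists_subset_hcpSumCube s K
  have hs' : s ⊆ envCube r K' := hs.trans (hcpSumCube_subset_envCube hr K')
  have hbox : ∑ v ∈ envCube r K, envTerm d lo false e t v ≤ ∑ v ∈ envBox lo nk K, envTerm d lo false e t v := by
    have h0 : ∑ v ∈ envCube r K, envTerm d lo false e t v =
        ∑ v ∈ (envCube r K).filter (fun v : ℤ × ℤ × ℤ => (lo : ℤ) ≤ v.1), envTerm d lo false e t v := by
      rw [Finset.sum_filter]
      refine Finset.sum_congr rfl fun v _ => ?_
      split_ifs with hv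
      · rfl
      · exact envTerm_of_not fun h => hv h.1
    rw [h0]
    refine Finset.sum_le_sum_of_subset_of_nonneg ?_ fun v _ _ => envTerm_nonneg d lo false e ht v
    intro v hv
    rw [Finset.mem_filter, env_mem_envCube] at hv
    rw [env_mem_envBox]
    obtain ⟨⟨hk, hi, hj⟩, hlo⟩ := hv
    refine ⟨⟨hlo, ?_⟩, hi, hj⟩
    have := (abs_le.1 hk).2
    push_cast at this ⊢
    have hnk' : ((r * K : ℕ) : ℤ) + 1 ≤ (lo : ℤ) + nk := by exact_mod_cast hnk
    push_cast at hnk'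
    omega
  calc ∑ v ∈ s, envTerm d lo false e t v
      ≤ ∑ v ∈ envCube r K', envTerm d lo false e t v :=
        Finset.sum_le_sum_of_subset_of_nonneg hs' fun v _ _ => envTerm_nonneg d lo false e ht v
    _ = ∑ v ∈ envCube r K' \ envCube r K, envTerm d lo false e t v + ∑ v ∈ envCube r K, envTerm d lo false e t v :=
        (Finset.sum_sdiff (envCube_mono r hKK')).symm
    _ ≤ envTail3 r α e K + ∑ v ∈ envBox lo nk K, envTerm d lo false e t v := by
        have := env_sum_sdiff_envCube_le d lo false he ht hα hα' hr hK hcond hKK'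
        linarith
    _ = _ := add_comm _ _

/-! ## Consequences: summability, truncation bounds, monotonicity -/

/-- **Summability** of every pattern sum for `e ≥ 3`, `t > 0`. [folklore] -/
theorem envTerm_summable (d lo : ℕ) (bdd : Bool) {e : ℕ} (he : 3 ≤ e) {t : ℝ} (ht : 0 < t) :
    Summable (envTerm d lo bdd e t) := by
  cases bdd
  · -- unbounded pattern: `r = 1`, `K = 4`, `α = min (3/5) t`
    have hα : 0 < min (3 / 5 : ℝ) t := lt_min (by norm_num) ht
    have hcond : min (3 / 5 : ℝ) t * ((4 : ℕ) + 1 : ℝ) ^ 2 ≤ (((1 : ℕ) : ℝ) * (4 : ℕ) + 1) ^ 2 * t := by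
      have := min_le_right (3 / 5 : ℝ) t
      push_cast
      nlinarith
    exact summable_of_sum_le (fun v => envTerm_nonneg d lo false e ht.le v)
      (env_far_sum_le d lo he ht.le hα (min_le_left _ _) (r := 1) (K := 4) (nk := 5) le_rfl le_rfl hcond
        (by omega))
  · exact summable_of_sum_le (fun v => envTerm_nonneg d lo true e ht.le v)
      (env_thin_sum_le d lo he ht.le (K := 4) le_rfl)

/-- The pattern sums are nonnegative (`t ≥ 0`). [folklore] -/
theorem envSum_nonneg (d lo : ℕ) (bdd : Bool) (e : ℕ) {t : ℝ} (ht : 0 ≤ t) : 0 ≤ envSum d lo bdd e t :=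
  tsum_nonneg fun v => envTerm_nonneg d lo bdd e ht v

/-- **Lower truncation bound**: every box sum is below the pattern sum (`e ≥ 3`, `t > 0`). [folklore] -/
theorem env_box_le_envSum (d lo : ℕ) (bdd : Bool) {e : ℕ} (he : 3 ≤ e) {t : ℝ} (ht : 0 < t) (nk K : ℕ) :
    ∑ v ∈ envBox lo nk K, envTerm d lo bdd e t v ≤ envSum d lo bdd e t :=
  (envTerm_summable d lo bdd he ht).sum_le_tsum _ fun v _ => envTerm_nonneg d lo bdd e ht.le v

/-- **Upper truncation bound, one-layer pattern**: `envSum ≤ box + envTail2 e K`. [folklore] -/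
theorem envSum_le_box_add_tail2 (d lo : ℕ) {e : ℕ} (he : 3 ≤ e) {t : ℝ} (ht : 0 < t) {K : ℕ} (hK : 4 ≤ K) :
    envSum d lo true e t ≤ ∑ v ∈ envBox lo 1 K, envTerm d lo true e t v + envTail2 e K :=
  Real.tsum_le_of_sum_le (fun v => envTerm_nonneg d lo true e ht.le v) (env_thin_sum_le d lo he ht.le hK)

/-- **Upper truncation bound, unbounded pattern**: `envSum ≤ box + envTail3 r α e K`. [folklore] -/
theorem envSum_le_box_add_tail3 (d lo : ℕ) {e : ℕ} (he : 3 ≤ e) {t : ℝ} (ht : 0 < t) {α : ℝ} (hα : 0 < α)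
    (hα' : α ≤ 3 / 5) {r K nk : ℕ} (hr : 1 ≤ r) (hK : 4 ≤ K)
    (hcond : α * ((K : ℝ) + 1) ^ 2 ≤ ((r : ℝ) * K + 1) ^ 2 * t) (hnk : r * K + 1 ≤ lo + nk) :
    envSum d lo false e t ≤ ∑ v ∈ envBox lo nk K, envTerm d lo false e t v + envTail3 r α e K :=
  Real.tsum_le_of_sum_le (fun v => envTerm_nonneg d lo false e ht.le v)
    (env_far_sum_le d lo he ht.le hα hα' hr hK hcond hnk)

/-- **Monotonicity**: every pattern sum is antitone in `t > 0` (`d ∈ {0,1}`, `e ≥ 3`). [folklore] -/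
theorem envSum_antitone {d : ℕ} (hd : d = 0 ∨ d = 1) (lo : ℕ) (bdd : Bool) {e : ℕ} (he : 3 ≤ e) {t₁ t₂ : ℝ}
    (h₁ : 0 < t₁) (h₁₂ : t₁ ≤ t₂) : envSum d lo bdd e t₂ ≤ envSum d lo bdd e t₁ :=
  (envTerm_summable d lo bdd he (h₁.trans_le h₁₂)).tsum_le_tsum (envTerm_antitone hd lo bdd e h₁ h₁₂)
    (envTerm_summable d lo bdd he h₁)

/-- The in-layer pattern does not see `t`: `envSum 0 0 true e t = envIn e`. [folklore] -/
theorem envSum_inLayer (e : ℕ) (t : ℝ) : envSum 0 0 true e t = envIn e := by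
  unfold envIn envSum
  refine tsum_congr fun v => ?_
  unfold envTerm
  split_ifs with hv
  · have hk : v.1 = 0 := by have := (envAdm_true_iff 0 v).1 hv; exact_mod_cast this.1
    simp [hk]
  · rfl

end Summit.AtomisticToContinuum.Crystallization.Theorems.PeriodicWindowsSketch

end
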